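import Literature.AnabelianGeometry.SemiGraphs.MetabelianLeafStarEscapeNotVerticial
import Literature.AnabelianGeometry.SemiGraphs.MetabelianLeafStarAnchored
import Literature.AnabelianGeometry.SemiGraphs.TemperedCompactVerticialOrCommutative
import Literature.AnabelianGeometry.SemiGraphs.TemperedGalFiniteSubgroupsBounded
import Literature.AnabelianGeometry.SemiGraphs.TemperedCompactInVerticialAt
import Literature.AnabelianGeometry.SemiGraphs.TemperedChartTransport
import HarnessLib

/-!
# An EXOTIC maximal compact subgroup of `π₁^temp(𝒢⋆(p))`: the (iv) sentence «every maximal compact subgroup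
# is verticial» FAILS at the rayless star («T37iv-ANCHOR-FREE@RAYLESS-STAR», file B1: the ∃-verdict)

Mochizuki, *Semi-graphs of anabelioids*, Publ. RIMS **42** (2006), §3, Theorem 3.7 (iv), manuscript p. 41
("the maximal compact subgroups of `π₁^temp(𝒢)` are precisely the verticial subgroups"; the printed proof is for
FINITE `𝔾`, kernel `maximalCompactIffVerticialAt_of_finiteGraph`) [cite: MochizukiSemiAnbd2006, Thm 3.7(iv) p.41].

PROOF-ONLY file (abc-iut cell, layer L3, row «T37iv-ANCHOR-FREE@RAYLESS-STAR» (L3-lead γ81 (b)/γ82 (2)/γ88 (1)),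
seat abc-iut-L3-t8 gen 7; no definition, no named fact).  At the rayless star `𝒢⋆(p) = metabelianLeafStar p`
(abc-iut-L3-t8 gen 6) the ∃-sentence of Thm 3.7 (iii) fails (p489415: the escaping procyclic `⟨c⟩‾ ≅ ℤ_p` lies in
no verticial subgroup), the ANCHORED forms of (iii)/(iv) hold (abc-iut-w6-d064, p494667/p495269/
`TemperedMaximalCompactAnchoredOfAbelianEdges`), and every compact subgroup is verticial-contained or commutative
(abc-iut-w6-d064, `TemperedCompactVerticialOrCommutative`).  The remaining (iv) sentence «every MAXIMAL compact
subgroup is verticial» is decided here, NEGATIVELY, by the cheapest route the tree affords: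

* `metabelianLeafStar_exists_isMaximalCompact_forall_not_le` — at the canonical chart there is a MAXIMAL compact
  subgroup `K` lying in NO verticial subgroup (hence not a verticial subgroup, anchor-free, and commutative): the
  tree's BINDER-FREE Zorn principle for the tempered fundamental group of Prop 3.6
  (`exists_isMaximalCompactSubgroup_ge_temperedPiChart`, abc-iut L3 lineage, `TemperedGalFiniteSubgroupsBounded.lean`:
  the finite subgroups of each `Gal(𝒢_{∞,n}/𝒢)` have bounded order) applied to the escaping `⟨c⟩‾` of
  `exists_escapeLimit`, with file A's per-element `escapeLimit_not_le_verticial`;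
* `metabelianLeafStar_exists_isMaximalCompact_not_mem` — the same at EVERY chart (transport along
  `TemperedPiChart.exists_compatIso`);
* `metabelianLeafStar_not_maximalCompactIffVerticialAt` — **`¬ MaximalCompactIffVerticialAt (metabelianLeafStar p)`**,
  `metabelianLeafStar_not_forall_isMaximalCompact_mem_verticial` — the (iv) ∀-sentence fails at every chart (the
  ∀-countable named fact F-1750 is already refuted in the tree at the locally finite ray `𝒢_θ`,
  abc-iut-w6-d063/w6-d120/L3-d4; the star is a second, RAYLESS carrier).

The SHARP structure — the escaping `⟨c⟩‾` is ITSELF maximal compact (no compact subgroup strictly contains it) —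
is file B2 (`MetabelianLeafStarEscapeSelfMaximal.lean`).  Honest framing: OUR typed tempered fundamental group of
OUR countable carrier; print's Thm 3.7 (iv) at finite `𝔾` and the anchored/class forms above are untouched kernel
theorems; nothing here bears on [IUTchIII] Cor. 3.12; no side taken; typed ≠ proved.
-/

noncomputable section

open CategoryTheory Topology

namespace Literature.AnabelianGeometry.SemiGraphs

/-! ### Transport of maximal compact subgroups along an isomorphism of topological groups -/

section Transport

variable {A B : Type} [Group A] [TopologicalSpace A] [Group B] [TopologicalSpace B]

/-- An isomorphism of topological groups carries maximal compact subgroups to maximal compact subgroups (the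
notion of Thm 3.7 (iv) / Def 3.8 is intrinsic to the topological group; local copy of the folklore transport,
cf. `IsMaximalCompactSubgroup.map_equiv`). [cite: MochizukiSemiAnbd2006, Thm 3.7(iv) p.41] -/
private theorem isMaximalCompactSubgroup_map_continuousMulEquiv (e : A ≃ₜ* B) {K : Subgroup A}
    (hK : IsMaximalCompactSubgroup K) : IsMaximalCompactSubgroup (K.map e.toMonoidHom) := by
  refine ⟨?_, fun K' hK' hle => ?_⟩
  · rw [Subgroup.coe_map]
    exact hK.1.image e.continuous
  · have hK'c : IsCompact ((K'.map e.symm.toMonoidHom : Subgroup A) : Set A) := by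
      rw [Subgroup.coe_map]
      exact hK'.image e.symm.continuous
    have hle' : K ≤ K'.map e.symm.toMonoidHom := fun x hx =>
      ⟨e x, hle ⟨x, hx, rfl⟩, e.symm_apply_apply x⟩
    have heq := hK.2 _ hK'c hle'
    refine le_antisymm (fun y hy => ?_) hle
    have hy' : e.symm y ∈ K := by
      rw [← heq]
      exact ⟨y, hy, rfl⟩
    exact ⟨e.symm y, hy', e.apply_symm_apply y⟩

end Transport

namespace ProfiniteSemiGraph

variable (p : ℕ) [hp : Fact p.Prime]

/-! ### The ∃-verdict at the canonical chart -/

/-- **`π₁^temp(𝒢⋆(p))` has a MAXIMAL compact subgroup lying in NO verticial subgroup** (canonical chart): the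
escaping `⟨c⟩‾` (`exists_escapeLimit`, in no verticial subgroup by `escapeLimit_not_le_verticial`) lies in a maximal
compact subgroup `K` by the tree's binder-free Zorn principle (`exists_isMaximalCompactSubgroup_ge_temperedPiChart`), and
`K` inherits «in no verticial subgroup»; so `K` is not verticial, is ANCHOR-FREE (`K ⊓ H = 1` for every verticial `H`,
abc-iut-w6-d064's anchored theorem) and COMMUTATIVE (abc-iut-w6-d064's dichotomy).
[cite: MochizukiSemiAnbd2006, Thm 3.7(iv) p.41] -/
theorem metabelianLeafStar_exists_isMaximalCompact_forall_not_le (h36 : (metabelianLeafStar p).Prop36Hypotheses) :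
    ∃ K : Subgroup ((metabelianLeafStar p).temperedPiChart h36).G, IsMaximalCompactSubgroup K ∧
      (∀ (v : (metabelianLeafStar p).graph.Vertex) (H : Subgroup ((metabelianLeafStar p).temperedPiChart h36).G),
        H ∈ verticialSubgroups ((metabelianLeafStar p).temperedPiChart h36) v → ¬ K ≤ H) ∧
      (∀ v : (metabelianLeafStar p).graph.Vertex,
        K ∉ verticialSubgroups ((metabelianLeafStar p).temperedPiChart h36) v) ∧
      (∀ (v : (metabelianLeafStar p).graph.Vertex) (H : Subgroup ((metabelianLeafStar p).temperedPiChart h36).G),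
        H ∈ verticialSubgroups ((metabelianLeafStar p).temperedPiChart h36) v → K ⊓ H = ⊥) ∧
      (∀ g₁ ∈ K, ∀ g₂ ∈ K, g₁ * g₂ = g₂ * g₁) ∧
      ∃ c : ((metabelianLeafStar p).temperedPiChart h36).G, (Subgroup.zpowers c).topologicalClosure ≤ K ∧
        ∀ (v : (metabelianLeafStar p).graph.Vertex) (H : Subgroup ((metabelianLeafStar p).temperedPiChart h36).G),
          H ∈ verticialSubgroups ((metabelianLeafStar p).temperedPiChart h36) v →
            ¬ (Subgroup.zpowers c).topologicalClosure ≤ H := by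
  classical
  obtain ⟨P₀⟩ := GaloisLevelData.nonempty_pointSeq h36 (leafStarCentre p)
  obtain ⟨c, N, hcN, hC, hact⟩ := exists_escapeLimit P₀
  have hno : ∀ (v : (metabelianLeafStar p).graph.Vertex) (H : Subgroup ((metabelianLeafStar p).temperedPiChart h36).G),
      H ∈ verticialSubgroups ((metabelianLeafStar p).temperedPiChart h36) v →
        ¬ (Subgroup.zpowers c).topologicalClosure ≤ H :=
    fun v H hH => escapeLimit_not_le_verticial P₀ c N hcN hact hH
  obtain ⟨K, hK, hCK⟩ :=
    (metabelianLeafStar p).exists_isMaximalCompactSubgroup_ge_temperedPiChart h36 _ hC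
  have hKno : ∀ (v : (metabelianLeafStar p).graph.Vertex) (H : Subgroup ((metabelianLeafStar p).temperedPiChart h36).G),
      H ∈ verticialSubgroups ((metabelianLeafStar p).temperedPiChart h36) v → ¬ K ≤ H :=
    fun v H hH hKH => hno v H hH (hCK.trans hKH)
  refine ⟨K, hK, hKno, fun v hKv => hKno v K hKv le_rfl, fun v H hH => ?_, ?_, c, hCK, hno⟩
  · exact metabelianLeafStar_inf_verticial_eq_bot_of_forall_not_le p _ K hK.1 hKno hH
  · rcases metabelianLeafStar_le_verticial_or_commutative p _ K hK.1 with ⟨v, H, hH, hKH⟩ | hcomm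
    · exact absurd hKH (hKno v H hH)
    · exact hcomm

/-- **`¬ MaximalCompactIffVerticialAt (metabelianLeafStar p)`**: [SemiAnbd] Thm 3.7 (iv) in its ∀-countable typing
FAILS at the rayless star — its clause «maximal compact ⇔ verticial» is violated at the canonical chart by the exotic
maximal compact subgroup above (the hypotheses of Thm 3.7 being theorems at `𝒢⋆(p)`,
`metabelianLeafStar_thm37Hypotheses'`). [cite: MochizukiSemiAnbd2006, Thm 3.7(iv) p.41] -/
theorem metabelianLeafStar_not_maximalCompactIffVerticialAt : ¬ MaximalCompactIffVerticialAt (metabelianLeafStar p) := by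
  intro hMV
  have h37 : (metabelianLeafStar p).Thm37Hypotheses := metabelianLeafStar_thm37Hypotheses' p
  obtain ⟨K, hK, -, hKnot, -⟩ :=
    metabelianLeafStar_exists_isMaximalCompact_forall_not_le p h37.toProp36Hypotheses
  obtain ⟨v, hv⟩ := ((hMV h37 ((metabelianLeafStar p).temperedPiChart h37.toProp36Hypotheses)).1 K).mp hK
  exact hKnot v hv

/- Remark.  The ∀-countable named fact F-1750 `MaximalCompactIffVerticial.{0}` is already refuted in the tree
(`not_maximalCompactIffVerticial`, carrier: the locally finite ray `𝒢_θ`, `ThetaRayRefutationMaximalCompact.lean`);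
`metabelianLeafStar_not_maximalCompactIffVerticialAt 2 (maximalCompactIffVerticial_iff_forall_at.mp h _)` re-derives
it from the present RAYLESS carrier. -/

/-! ### Every chart -/

/-- **At EVERY chart of `π₁^temp(𝒢⋆(p))` there is a maximal compact subgroup that is NOT a verticial subgroup**
(indeed lies in none), commutative — transport of the canonical-chart witness along the compatible isomorphism
of charts (`TemperedPiChart.exists_compatIso`, `mem_verticialSubgroups_iff_map`).
[cite: MochizukiSemiAnbd2006, Thm 3.7(iv) p.41] -/
theorem metabelianLeafStar_exists_isMaximalCompact_not_mem (c : TemperedPiChart (metabelianLeafStar p)) :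
    ∃ K : Subgroup c.G, IsMaximalCompactSubgroup K ∧
      (∀ (v : (metabelianLeafStar p).graph.Vertex) (H : Subgroup c.G), H ∈ verticialSubgroups c v → ¬ K ≤ H) ∧
      (∀ v : (metabelianLeafStar p).graph.Vertex, K ∉ verticialSubgroups c v) ∧
      ∀ g₁ ∈ K, ∀ g₂ ∈ K, g₁ * g₂ = g₂ * g₁ := by
  have h36 : (metabelianLeafStar p).Prop36Hypotheses := (metabelianLeafStar_thm37Hypotheses' p).toProp36Hypotheses
  obtain ⟨φ, ψ, hψφ, hφψ, hφ, hψ⟩ := TemperedPiChart.exists_compatIso ((metabelianLeafStar p).temperedPiChart h36) c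
  obtain ⟨K₀, hK₀, hK₀no, -, -, hK₀comm, -⟩ := metabelianLeafStar_exists_isMaximalCompact_forall_not_le p h36
  -- the compatible isomorphism of charts as a `ContinuousMulEquiv`
  let e : ((metabelianLeafStar p).temperedPiChart h36).G ≃ₜ* c.G :=
    { toFun := φ, invFun := ψ, left_inv := hψφ, right_inv := hφψ, map_mul' := map_mul φ,
      continuous_toFun := φ.continuous, continuous_invFun := ψ.continuous }
  have he : e.toMonoidHom = φ.toMonoidHom := rfl
  have hback : (K₀.map φ.toMonoidHom).map ψ.toMonoidHom = K₀ := by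
    rw [Subgroup.map_map]
    conv_rhs => rw [← Subgroup.map_id K₀]
    congr 1
    ext x
    exact hψφ x
  have hno : ∀ (v : (metabelianLeafStar p).graph.Vertex) (H : Subgroup c.G), H ∈ verticialSubgroups c v →
      ¬ K₀.map φ.toMonoidHom ≤ H := by
    intro v H hH hle
    have hH' : H.map ψ.toMonoidHom ∈ verticialSubgroups ((metabelianLeafStar p).temperedPiChart h36) v :=
      (mem_verticialSubgroups_iff_map φ hφ ψ hφψ hψ H).mp hH
    refine hK₀no v _ hH' fun x hx => ?_
    exact ⟨φ x, hle ⟨x, hx, rfl⟩, hψφ x⟩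
  refine ⟨K₀.map φ.toMonoidHom, ?_, hno, fun v hKv => hno v _ hKv le_rfl, ?_⟩
  · rw [← he]
    exact isMaximalCompactSubgroup_map_continuousMulEquiv e hK₀
  · rintro _ ⟨g₁, hg₁, rfl⟩ _ ⟨g₂, hg₂, rfl⟩
    change φ g₁ * φ g₂ = φ g₂ * φ g₁
    rw [← map_mul, ← map_mul, hK₀comm g₁ hg₁ g₂ hg₂]

/-- **The (iv) ∀-sentence «every maximal compact subgroup is verticial» FAILS at `𝒢⋆(p)`, at every chart.**
[cite: MochizukiSemiAnbd2006, Thm 3.7(iv) p.41] -/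
theorem metabelianLeafStar_not_forall_isMaximalCompact_mem_verticial (c : TemperedPiChart (metabelianLeafStar p)) :
    ¬ ∀ K : Subgroup c.G, IsMaximalCompactSubgroup K →
      ∃ v : (metabelianLeafStar p).graph.Vertex, K ∈ verticialSubgroups c v := by
  intro h
  obtain ⟨K, hK, -, hKnot, -⟩ := metabelianLeafStar_exists_isMaximalCompact_not_mem p c
  obtain ⟨v, hv⟩ := h K hK
  exact hKnot v hv

end ProfiniteSemiGraph

end Literature.AnabelianGeometry.SemiGraphs

end
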